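import Literature.AlgebraicGeometry.Resolution.CurveConfigurationPairStep
import HarnessLib

/-!
# Embedded resolution of a configuration of curves by blowing up closed points — termination
# (Cossart–Piltant 2008, Prop. 4.4, steps 1–2, the pure curve-configuration slice; measure of Stacks Tag 0BIC)

Topic: `Literature/AlgebraicGeometry/Resolution`. Sibling of `EmbeddedCurvePointBlowups.lean` (the ONE-curve
lemma, Liu 9.2.32). Last of four files (`CurveConfigurationStrictTransform`, `CurveConfigurationMultiplicity`,
`CurveConfigurationPairStep`): the theorem `false_of_badPointChain_of_curveConfiguration`, whose statement was
audited before proof (cell res-hironaka, D-0154 (2) inputs cell, critic res-inputs-crit-1 R42; candidate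
`plan/inputs/candidates/F71_T2aPrime_CurveConfiguration_SIGNATURE.lean` sha16 b2596c3bdf54ddcd — binders
unchanged here).

Printed source. Cossart–Piltant, J. Algebra 320 (2008), proof of Prop. 4.4, p. 10: «1- If `Σ(i)` has an
irreducible component of dimension one which is singular, let `X(i+1)` be the blowing up of `X(i)` along any such
singular point. Otherwise go to 2. 2- If `Σ(i)` has regular components of dimension one which do not intersect
transversally, let `X(i+1)` be the blowing up of `X(i)` along any such non-transverse intersection point. … each
exceptional curve in `Σ(i+1)` created by the algorithm is regular. By embedded resolution of curves, we have
`s(i) ≥ 2` for `i >> 0`. If `s(i) = 2` for some `i ≥ 0`, any exceptional curve in `Σ(i+1)` created by the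
algorithm is transverse to the strict transforms of each one dimensional irreducible component of `Σ(i)`. By
embedded resolution of (reducible) curves, we have `s(i) ≥ 3` for `i >> 0`.» The measure is the one of The Stacks
Project, Tag 0BIC (Lemma 54.15.6, proof ¶2): first the `δ`-invariants, then the intersection multiplicities
`m_p(Y_i ∩ Y_j)` (Tag 0BI6), which drop under point blow-ups (Tag 0BI7).

WHAT IS ABSTRACTED AWAY (left to the F-71 consumer): the identification of the configuration `𝒞 n` with the
one-dimensional irreducible components of `Σ(n) = {ord J(n) = μ}` — after the blowing up of a point `x ∈ Σ(n)` the
one-dimensional components of `Σ(n+1)` are strict transforms `closure (π⁻¹(C ∖ {x}))` of those of `Σ(n)` together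
with AT MOST the projective line of near points (CP Lemma 4.3 (1)(3)(5); tree `NearPointsPointCentreLine*.lean`),
which is regular and transverse to the strict transform of every component regular at `x` (Tag 0BI7 (2)). Here
the configurations are ANY finite sets of integral curves subject to exactly these two rules, in ANY locally
Noetherian ambient schemes (no regularity, no dimension bound on `X`).

PROOF. Lexicographic measure (`Σ_{C ∈ 𝒞 n} Σ_y δ(𝒪_{V(𝓘_C),y})`, `Σ_{C ≠ C'} Σ_{p ∈ C ∩ C'} (m_p(C ∩ C') − 1)`) in
`ℕ ×ₗ ℕ`. At a centre where some member is singular the first entry drops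
(`finsum_pointDelta_strictTransform_le_and_lt`; new regular curves weigh `0`, dropped curves only help); at a
centre where all members through it are regular the first entry does not increase and the second drops
(`sum_length_strictTransform_le_and_lt`; pairs involving a new curve weigh `0` by transversality). The finite-sum
bookkeeping is `sum_lt_sum_of_transform` / `sum_offDiag_lt_sum_offDiag_of_transform` (the strict transform is
injective on a configuration of pairwise incomparable curves). Kernel-checked; no new definitions; axioms standard.
AI-written; weaker than expert review. F-71 `CossartPiltant2008_prop44` is NOT discharged by this file; no summit
statement is proved.

## References
* V. Cossart, O. Piltant, J. Algebra 320 (2008) 1051–1082, Prop. 4.4 (proof, p. 10, steps 1–2). [CossartPiltant2008]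
* The Stacks Project, Tag 0BIC (Lemma 54.15.6, proof), Tags 0BI6, 0BI7, 02OS. [StacksProject]
* Q. Liu, *Algebraic Geometry and Arithmetic Curves* (2002), §9.2.4 Lemma 2.32. [Liu2002]
-/

noncomputable section

open CategoryTheory AlgebraicGeometry TopologicalSpace IsLocalRing

universe u

namespace Literature.AlgebraicGeometry.Resolution

open Scheme.IdealSheafData

namespace CurveConfiguration

/-- `ENat.toNat` is strictly monotone below a finite bound. [folklore] -/
private theorem toNat_lt_toNat_of_lt_of_ne_top {a b : ℕ∞} (h : a < b) (hb : b ≠ ⊤) : a.toNat < b.toNat := by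
  have ha : a ≠ ⊤ := ne_top_of_lt h
  lift a to ℕ using ha
  lift b to ℕ using hb
  simpa using h

/-! ## Bookkeeping: sums over a configuration and over its successor -/

section Combinatorics

variable {α β : Type*}

/-- **Sum bookkeeping, one curve at a time.** If every member of the new configuration with a non-zero weight
is the transform of an old member, the transform is injective on the old configuration, and the weight of a
transform never exceeds the weight of the curve, then the total weight does not increase; it drops if one weight
drops. [folklore] -/
private theorem sum_le_sum_of_transform [DecidableEq β] {S : Finset α} {S' : Finset β} (st : α → β)
    (hinj : ∀ a ∈ S, ∀ a' ∈ S, st a = st a' → a = a') (f : α → ℕ) (f' : β → ℕ)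
    (hzero : ∀ b ∈ S', f' b ≠ 0 → ∃ a ∈ S, st a = b) (hle : ∀ a ∈ S, f' (st a) ≤ f a) :
    ∑ b ∈ S', f' b ≤ ∑ a ∈ S, f a :=
  calc ∑ b ∈ S', f' b ≤ ∑ b ∈ S.image st, f' b := Finset.sum_le_sum_of_ne_zero (fun b hb hne => by
          obtain ⟨a, ha, rfl⟩ := hzero b hb hne; exact Finset.mem_image_of_mem st ha)
    _ = ∑ a ∈ S, f' (st a) := Finset.sum_image hinj
    _ ≤ ∑ a ∈ S, f a := Finset.sum_le_sum hle

/-- The strict form of `sum_le_sum_of_transform`. [folklore] -/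
private theorem sum_lt_sum_of_transform [DecidableEq β] {S : Finset α} {S' : Finset β} (st : α → β)
    (hinj : ∀ a ∈ S, ∀ a' ∈ S, st a = st a' → a = a') (f : α → ℕ) (f' : β → ℕ)
    (hzero : ∀ b ∈ S', f' b ≠ 0 → ∃ a ∈ S, st a = b) (hle : ∀ a ∈ S, f' (st a) ≤ f a)
    (hlt : ∃ a ∈ S, f' (st a) < f a) :
    ∑ b ∈ S', f' b < ∑ a ∈ S, f a :=
  calc ∑ b ∈ S', f' b ≤ ∑ b ∈ S.image st, f' b := Finset.sum_le_sum_of_ne_zero (fun b hb hne => by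
          obtain ⟨a, ha, rfl⟩ := hzero b hb hne; exact Finset.mem_image_of_mem st ha)
    _ = ∑ a ∈ S, f' (st a) := Finset.sum_image hinj
    _ < ∑ a ∈ S, f a := Finset.sum_lt_sum hle hlt

/-- **Sum bookkeeping over pairs of distinct curves.** If a pair of distinct new members with non-zero weight
consists of transforms of old members, the transform is injective on the old configuration, the weight of a
pair of transforms never exceeds the weight of the pair, and it drops for one pair, then the total pair weight
drops. [folklore] -/
private theorem sum_offDiag_lt_sum_offDiag_of_transform [DecidableEq α] [DecidableEq β] {S : Finset α} {S' : Finset β}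
    (st : α → β) (hinj : ∀ a ∈ S, ∀ a' ∈ S, st a = st a' → a = a') (g : α → α → ℕ) (g' : β → β → ℕ)
    (hzero : ∀ b ∈ S', ∀ b' ∈ S', b ≠ b' → g' b b' ≠ 0 → (∃ a ∈ S, st a = b) ∧ (∃ a ∈ S, st a = b'))
    (hle : ∀ a ∈ S, ∀ a' ∈ S, a ≠ a' → g' (st a) (st a') ≤ g a a')
    (hlt : ∃ a ∈ S, ∃ a' ∈ S, a ≠ a' ∧ g' (st a) (st a') < g a a') :
    ∑ p ∈ S'.offDiag, g' p.1 p.2 < ∑ p ∈ S.offDiag, g p.1 p.2 := by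
  let st2 : α × α → β × β := fun p => (st p.1, st p.2)
  have hinj2 : ∀ p ∈ S.offDiag, ∀ p' ∈ S.offDiag, st2 p = st2 p' → p = p' := by
    intro p hp p' hp' h
    rw [Finset.mem_offDiag] at hp hp'
    have h1 : st p.1 = st p'.1 := congrArg Prod.fst h
    have h2 : st p.2 = st p'.2 := congrArg Prod.snd h
    exact Prod.ext (hinj _ hp.1 _ hp'.1 h1) (hinj _ hp.2.1 _ hp'.2.1 h2)
  calc ∑ p ∈ S'.offDiag, g' p.1 p.2 ≤ ∑ p ∈ S.offDiag.image st2, g' p.1 p.2 :=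
        Finset.sum_le_sum_of_ne_zero (fun p hp hne => by
          rw [Finset.mem_offDiag] at hp
          obtain ⟨⟨a, ha, h1⟩, ⟨a', ha', h2⟩⟩ := hzero p.1 hp.1 p.2 hp.2.1 hp.2.2 hne
          refine Finset.mem_image.mpr ⟨(a, a'), Finset.mem_offDiag.mpr ⟨ha, ha', ?_⟩, Prod.ext h1 h2⟩
          intro haa'
          have haa : a = a' := haa'
          rw [haa] at h1
          exact hp.2.2 (h1.symm.trans h2))
    _ = ∑ p ∈ S.offDiag, g' (st2 p).1 (st2 p).2 := Finset.sum_image hinj2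
    _ < ∑ p ∈ S.offDiag, g p.1 p.2 := by
        apply Finset.sum_lt_sum
        · intro p hp
          rw [Finset.mem_offDiag] at hp
          exact hle _ hp.1 _ hp.2.1 hp.2.2
        · obtain ⟨a, ha, a', ha', hne, h⟩ := hlt
          exact ⟨(a, a'), Finset.mem_offDiag.mpr ⟨ha, ha', hne⟩, h⟩

end Combinatorics

end CurveConfiguration

open CurveConfiguration in
/-- **Blowing up bad points of a configuration of curves terminates (embedded resolution of reducible curves by point
blow-ups, with exceptional curves thrown in along the way)** — Cossart–Piltant 2008, proof of Prop. 4.4, steps 1–2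
(p. 10): «By embedded resolution of curves, we have `s(i) ≥ 2` for `i >> 0` … By embedded resolution of (reducible)
curves, we have `s(i) ≥ 3` for `i >> 0`», in the following PURE form. DATA: a chain of blowing ups
`π n : X(n+1) → X(n)` of locally Noetherian schemes at closed points `x n` (universal property, `IsBlowup`, reduced
centre `𝓘_{x n}`), and at every stage a FINITE set `𝒞 n` of CURVES: closed subsets `C ⊆ X(n)` whose reduced induced
closed subscheme `V(𝓘_C)` (`(vanishingIdeal C).subscheme`) is integral, Noetherian, quasi-excellent and of dimension
one, pairwise incomparable. RULES: (bad point) `x n` lies on a curve `C ∈ 𝒞 n` which is either singular at `x n`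
(the point of `V(𝓘_C)` over `x n` is not in the regular locus) or meets another curve `C' ∈ 𝒞 n` at `x n`
non-transversally (`𝓘_{C,x} + 𝓘_{C',x} ≠ 𝔪_x`); (successors) every curve of `𝒞 (n+1)` is either the strict
transform `closure (π n ⁻¹ (C ∖ {x n}))` of a curve `C ∈ 𝒞 n`, or a NEW curve which is regular and transverse, at
every common point, to every other member of `𝒞 (n+1)` except possibly the strict transforms of curves singular at
`x n` («each exceptional curve … created by the algorithm is regular», «transverse to the strict transforms of each
one dimensional irreducible component»; the exception is the cusp, whose strict transform may touch the new line —
harmless because `Σ δ` has just dropped). CONCLUSION: there is no such infinite chain. Measure: lexicographic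
(`Σ_{C ∈ 𝒞 n} Σ_c δ(𝒪_{V(𝓘_C),c})`, `Σ_{C ≠ C'} Σ_{p ∈ C ∩ C'} (m_p(C ∩ C') − 1)`) with
`m_p(C ∩ C') = ℓ(𝒪_{X,p} ⧸ (𝓘_{C,p} + 𝓘_{C',p}))` (Stacks Tag 0BI6); the first entry drops at a singular point
(`IsBlowup.finsum_pointDelta_strictTransform_lt`) and never increases, the second drops at a non-transverse point of
regular branches (`Stacks0BI7_core`) while the first is unchanged (`Stacks0BI7_clause1`).
[cite: CossartPiltant2008, Prop. 4.4 (proof, p. 10, steps 1–2)] [cite: StacksProject, Tag 0BIC (Lemma 54.15.6, proof)] -/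
theorem false_of_badPointChain_of_curveConfiguration
    (Xs : ℕ → Scheme.{u}) [∀ n, IsLocallyNoetherian (Xs n)]
    (π : ∀ n, Xs (n + 1) ⟶ Xs n) (x : ∀ n, Xs n) (hx : ∀ n, IsClosed ({x n} : Set (Xs n)))
    (hπ : ∀ n, IsBlowup (π n) (vanishingIdeal ⟨{x n}, hx n⟩))
    (𝒞 : ∀ n, Set (Closeds (Xs n))) (hfin : ∀ n, (𝒞 n).Finite)
    (hint : ∀ n, ∀ C ∈ 𝒞 n, IsIntegral (vanishingIdeal C).subscheme)
    (hnoeth : ∀ n, ∀ C ∈ 𝒞 n, IsNoetherian (vanishingIdeal C).subscheme)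
    (hqe : ∀ n, ∀ C ∈ 𝒞 n, Scheme.IsQuasiExcellent (vanishingIdeal C).subscheme)
    (hdim : ∀ n, ∀ C ∈ 𝒞 n, topologicalKrullDim (vanishingIdeal C).subscheme = 1)
    (hinc : ∀ n, ∀ C ∈ 𝒞 n, ∀ C' ∈ 𝒞 n, (C : Set (Xs n)) ⊆ C' → C = C')
    (hbad : ∀ n, ∃ C ∈ 𝒞 n,
      x n ∈ (vanishingIdeal C).subschemeι '' (Scheme.regularLocus (vanishingIdeal C).subscheme)ᶜ ∨
      (x n ∈ (C : Set (Xs n)) ∧ ∃ C' ∈ 𝒞 n, C' ≠ C ∧ x n ∈ (C' : Set (Xs n)) ∧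
        stalkIdeal (vanishingIdeal C) (x n) ⊔ stalkIdeal (vanishingIdeal C') (x n) ≠
          maximalIdeal ((Xs n).presheaf.stalk (x n))))
    (hnext : ∀ n, ∀ C' ∈ 𝒞 (n + 1),
      (∃ C ∈ 𝒞 n, (C' : Set (Xs (n + 1))) = closure (π n ⁻¹' ((C : Set (Xs n)) \ {x n}))) ∨
      (Scheme.IsRegular (vanishingIdeal C').subscheme ∧
        ∀ D ∈ 𝒞 (n + 1), D ≠ C' →
          (¬ ∃ C ∈ 𝒞 n, (D : Set (Xs (n + 1))) = closure (π n ⁻¹' ((C : Set (Xs n)) \ {x n})) ∧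
              x n ∈ (vanishingIdeal C).subschemeι '' (Scheme.regularLocus (vanishingIdeal C).subscheme)ᶜ) →
          ∀ q ∈ (C' : Set (Xs (n + 1))) ∩ (D : Set (Xs (n + 1))),
            stalkIdeal (vanishingIdeal C') q ⊔ stalkIdeal (vanishingIdeal D) q =
              maximalIdeal ((Xs (n + 1)).presheaf.stalk q))) :
    False := by
  classical
  -- the strict transform of a closed set, and the `singular at the centre` predicate
  let st : (n : ℕ) → Closeds (Xs n) → Closeds (Xs (n + 1)) := fun n C =>
    ⟨closure (π n ⁻¹' ((C : Set (Xs n)) \ {x n})), isClosed_closure⟩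
  -- the weights: `Σ δ` of a member, `m_p(C ∩ C')`, the tangency excess of a pair, and the two totals
  let dC : (n : ℕ) → Closeds (Xs n) → ℕ := fun n C =>
    if h : C ∈ 𝒞 n then
      (haveI := hint n C h; ∑ᶠ y, pointDelta (vanishingIdeal C).subscheme y).toNat else 0
  let mC : (n : ℕ) → Closeds (Xs n) → Closeds (Xs n) → Xs n → ℕ := fun n C C' p =>
    (Module.length ((Xs n).presheaf.stalk p) ((Xs n).presheaf.stalk p ⧸
      (stalkIdeal (vanishingIdeal C) p ⊔ stalkIdeal (vanishingIdeal C') p))).toNat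
  let tC : (n : ℕ) → Closeds (Xs n) → Closeds (Xs n) → ℕ := fun n C C' =>
    if h : ((C : Set (Xs n)) ∩ (C' : Set (Xs n))).Finite then ∑ p ∈ h.toFinset, (mC n C C' p - 1) else 0
  let D : ℕ → ℕ := fun n => ∑ C ∈ (hfin n).toFinset, dC n C
  let T : ℕ → ℕ := fun n => ∑ P ∈ (hfin n).toFinset.offDiag, tC n P.1 P.2
  -- the lexicographic measure drops at every step
  have hstep : ∀ n, toLex (D (n + 1), T (n + 1)) < toLex (D n, T n) := by
    intro n
    have hmemS : ∀ {C}, C ∈ (hfin n).toFinset ↔ C ∈ 𝒞 n := fun {C} => Set.Finite.mem_toFinset _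
    have hmemS' : ∀ {C}, C ∈ (hfin (n + 1)).toFinset ↔ C ∈ 𝒞 (n + 1) := fun {C} => Set.Finite.mem_toFinset _
    -- (F1) the strict transform is injective on the configuration
    have hinj : ∀ C ∈ (hfin n).toFinset, ∀ C' ∈ (hfin n).toFinset, st n C = st n C' → C = C' := by
      intro C hC C' hC' heq
      rw [hmemS] at hC hC'
      have heq' : closure (π n ⁻¹' ((C : Set (Xs n)) \ {x n})) = closure (π n ⁻¹' ((C' : Set (Xs n)) \ {x n})) :=
        congrArg (fun Z : Closeds (Xs (n + 1)) => (Z : Set (Xs (n + 1)))) heq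
      have key : ∀ p : Xs n, p ≠ x n → (p ∈ (C : Set (Xs n)) ↔ p ∈ (C' : Set (Xs n))) := by
        intro p hp
        obtain ⟨q, hq, -⟩ := IsBlowup.existsUnique_preimage_of_ne (hπ n) (coe_support_vanishingIdeal _) hp
        have hqx : π n q ≠ x n := by rw [hq]; exact hp
        rw [← hq, ← mem_closure_preimage_diff_iff (π n).continuous C hqx, heq',
          mem_closure_preimage_diff_iff (π n).continuous C' hqx]
      by_cases hxC' : x n ∈ (C' : Set (Xs n))
      · refine hinc n C hC C' hC' fun p hp => ?_
        by_cases hpx : p = x n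
        · rw [hpx]; exact hxC'
        · exact (key p hpx).mp hp
      · refine (hinc n C' hC' C hC fun p hp => ?_).symm
        have hpx : p ≠ x n := by rintro rfl; exact hxC' hp
        exact (key p hpx).mpr hp
    -- (F2) the `δ`-weight of a transform
    have hδ : ∀ C ∈ 𝒞 n, dC (n + 1) (st n C) ≤ dC n C ∧
        (x n ∈ (vanishingIdeal C).subschemeι '' (Scheme.regularLocus (vanishingIdeal C).subscheme)ᶜ →
          dC (n + 1) (st n C) < dC n C) := by
      intro C hC
      haveI := hint n C hC
      haveI := hnoeth n C hC
      haveI : IsIntegral (vanishingIdeal (st n C)).subscheme :=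
        isIntegral_subscheme_vanishingIdeal_strictTransform (hπ n) C (hdim n C hC)
      have hK : strictTransformIdeal (π n) (vanishingIdeal ⟨{x n}, hx n⟩) (vanishingIdeal C).subschemeι.ker =
          vanishingIdeal (st n C) := by
        rw [ker_subschemeι]; exact strictTransformIdeal_vanishingIdeal_eq (hπ n) C (hdim n C hC)
      obtain ⟨hle, hlt⟩ := finsum_pointDelta_strictTransform_le_and_lt (hπ n) C (hqe n C hC) (hdim n C hC)
        (vanishingIdeal (st n C)) hK
      have htop := finsum_pointDelta_ne_top (hqe n C hC) (hdim n C hC).le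
      have hdCn : dC n C = (∑ᶠ y, pointDelta (vanishingIdeal C).subscheme y).toNat := by
        simp only [dC, dif_pos hC]
      have hdC' : dC (n + 1) (st n C) ≤ (∑ᶠ y, pointDelta (vanishingIdeal (st n C)).subscheme y).toNat := by
        by_cases hmem : st n C ∈ 𝒞 (n + 1)
        · simp only [dC, dif_pos hmem]; exact le_rfl
        · simp only [dC, dif_neg hmem]; exact Nat.zero_le _
      refine ⟨hdC'.trans (hdCn ▸ ENat.toNat_le_toNat hle htop), fun hsing => ?_⟩
      exact lt_of_le_of_lt hdC' (hdCn ▸ toNat_lt_toNat_of_lt_of_ne_top (hlt hsing) htop)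
    -- (F3) a new member with non-zero `δ`-weight is a transform
    have hδ0 : ∀ C' ∈ (hfin (n + 1)).toFinset, dC (n + 1) C' ≠ 0 → ∃ C ∈ (hfin n).toFinset, st n C = C' := by
      intro C' hC' hne
      rw [hmemS'] at hC'
      rcases hnext n C' hC' with ⟨C, hC, hCC'⟩ | ⟨hreg, -⟩
      · exact ⟨C, hmemS.mpr hC, Closeds.ext hCC'.symm⟩
      · exfalso; apply hne
        haveI := hint (n + 1) C' hC'
        simp only [dC, dif_pos hC']
        rw [finsum_pointDelta_eq_zero_of_isRegular (hdim (n + 1) C' hC') hreg]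
        rfl
    by_cases hA : ∃ C ∈ 𝒞 n,
        x n ∈ (vanishingIdeal C).subschemeι '' (Scheme.regularLocus (vanishingIdeal C).subscheme)ᶜ
    · -- Case A: a singular centre — `Σ δ` drops
      have hD : D (n + 1) < D n := by
        apply sum_lt_sum_of_transform (st n) hinj (dC n) (dC (n + 1)) hδ0
        · intro C hC; exact (hδ C (hmemS.mp hC)).1
        · obtain ⟨C, hC, hsing⟩ := hA
          exact ⟨C, hmemS.mpr hC, (hδ C hC).2 hsing⟩
      exact Prod.Lex.toLex_lt_toLex.mpr (Or.inl hD)  -- to be fixed to the right lemma name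
    · -- Case B: every member through the centre is regular there — `Σ δ` does not increase, `Σ (m-1)` drops
      push Not at hA
      have hD : D (n + 1) ≤ D n :=
        sum_le_sum_of_transform (st n) hinj (dC n) (dC (n + 1)) hδ0 fun C hC => (hδ C (hmemS.mp hC)).1
      have hT : T (n + 1) < T n := by
        apply sum_offDiag_lt_sum_offDiag_of_transform (st n) hinj (tC n) (tC (n + 1))
        · -- pairs with a new member have weight zero
          intro B hB B' hB' hBB' hne
          rw [hmemS'] at hB hB'
          -- transversality of a new member `N` against any other member `E` (no exemption in Case B)
          have htrans : ∀ N ∈ 𝒞 (n + 1), ∀ E ∈ 𝒞 (n + 1), E ≠ N →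
              (¬ ∃ C ∈ 𝒞 n, (N : Set (Xs (n + 1))) = closure (π n ⁻¹' ((C : Set (Xs n)) \ {x n}))) →
              ∀ q ∈ (N : Set (Xs (n + 1))) ∩ (E : Set (Xs (n + 1))),
                stalkIdeal (vanishingIdeal N) q ⊔ stalkIdeal (vanishingIdeal E) q =
                  maximalIdeal ((Xs (n + 1)).presheaf.stalk q) := by
            intro N hN E hE hEN hnew q hq
            rcases hnext n N hN with himg | ⟨-, h⟩
            · exact absurd himg hnew
            · refine h E hE hEN ?_ q hq
              rintro ⟨C, hC, -, hsing⟩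
              exact hA C hC hsing
          have hzero : ∀ N ∈ 𝒞 (n + 1), ∀ E ∈ 𝒞 (n + 1), E ≠ N →
              (¬ ∃ C ∈ 𝒞 n, (N : Set (Xs (n + 1))) = closure (π n ⁻¹' ((C : Set (Xs n)) \ {x n}))) →
              tC (n + 1) N E = 0 ∧ tC (n + 1) E N = 0 := by
            intro N hN E hE hEN hnew
            have hm : ∀ q ∈ (N : Set (Xs (n + 1))) ∩ (E : Set (Xs (n + 1))), mC (n + 1) N E q = 1 ∧
                mC (n + 1) E N q = 1 := by
              intro q hq
              have h1 := (length_stalk_quotient_sup_eq_one_iff N E q).mpr (htrans N hN E hE hEN hnew q hq)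
              have h2 : stalkIdeal (vanishingIdeal E) q ⊔ stalkIdeal (vanishingIdeal N) q =
                  maximalIdeal ((Xs (n + 1)).presheaf.stalk q) := by
                rw [sup_comm]; exact htrans N hN E hE hEN hnew q hq
              have h2' := (length_stalk_quotient_sup_eq_one_iff E N q).mpr h2
              simp only [mC, h1, h2']
              exact ⟨rfl, rfl⟩
            constructor
            · simp only [tC]
              split_ifs with hF
              · apply Finset.sum_eq_zero
                intro q hq
                rw [Set.Finite.mem_toFinset] at hq
                rw [(hm q hq).1]
                rfl
              · rfl
            · simp only [tC]
              split_ifs with hF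
              · apply Finset.sum_eq_zero
                intro q hq
                rw [Set.Finite.mem_toFinset] at hq
                rw [(hm q ⟨hq.2, hq.1⟩).2]
                rfl
              · rfl
          by_contra hcon
          rw [not_and_or] at hcon
          rcases hcon with hB0 | hB'0
          · have hnew : ¬ ∃ C ∈ 𝒞 n, (B : Set (Xs (n + 1))) = closure (π n ⁻¹' ((C : Set (Xs n)) \ {x n})) := by
              rintro ⟨C, hC, hCB⟩
              exact hB0 ⟨C, hmemS.mpr hC, Closeds.ext hCB.symm⟩
            exact hne (hzero B hB B' hB' hBB'.symm hnew).1
          · have hnew : ¬ ∃ C ∈ 𝒞 n, (B' : Set (Xs (n + 1))) = closure (π n ⁻¹' ((C : Set (Xs n)) \ {x n})) := by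
              rintro ⟨C, hC, hCB⟩
              exact hB'0 ⟨C, hmemS.mpr hC, Closeds.ext hCB.symm⟩
            exact hne (hzero B' hB' B hB hBB' hnew).2
        · -- pairs of transforms: the per-pair lemma
          intro C hC C' hC' hCC'
          rw [hmemS] at hC hC'
          haveI := hint n C hC; haveI := hnoeth n C hC; haveI := hint n C' hC'
          have hnsub : ¬ (C : Set (Xs n)) ⊆ C' := fun h => hCC' (hinc n C hC C' hC' h)
          have hF := finite_inter_of_not_subset C C' (hdim n C hC) hnsub
          have hF' := finite_strictTransform_inter (hπ n) C C' (hdim n C hC) (hA C hC) hF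
          have h := (sum_length_strictTransform_le_and_lt (hπ n) C C' (hdim n C hC) (hdim n C' hC') hnsub (hA C hC)
            hF hF').1
          have hF'' : ((st n C : Set (Xs (n + 1))) ∩ (st n C' : Set (Xs (n + 1)))).Finite := hF'
          simp only [tC, dif_pos hF, dif_pos hF'']
          exact h
        · -- the bad pair
          obtain ⟨C, hC, hbad'⟩ := hbad n
          rcases hbad' with hsing | ⟨hxC, C', hC', hC'C, hxC', hne⟩
          · exact absurd hsing (hA C hC)
          haveI := hint n C hC; haveI := hnoeth n C hC; haveI := hint n C' hC'
          have hnsub : ¬ (C : Set (Xs n)) ⊆ C' := fun h => hC'C (hinc n C hC C' hC' h).symm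
          have hF := finite_inter_of_not_subset C C' (hdim n C hC) hnsub
          have hF' := finite_strictTransform_inter (hπ n) C C' (hdim n C hC) (hA C hC) hF
          have h := (sum_length_strictTransform_le_and_lt (hπ n) C C' (hdim n C hC) (hdim n C' hC') hnsub (hA C hC)
            hF hF').2 hxC hxC' hne
          have hF'' : ((st n C : Set (Xs (n + 1))) ∩ (st n C' : Set (Xs (n + 1)))).Finite := hF'
          refine ⟨C, hmemS.mpr hC, C', hmemS.mpr hC', fun h => hC'C h.symm, ?_⟩
          simp only [tC, dif_pos hF, dif_pos hF'']
          exact h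
      rcases hD.lt_or_eq with hDlt | hDeq
      · exact Prod.Lex.toLex_lt_toLex.mpr (Or.inl hDlt)
      · exact Prod.Lex.toLex_lt_toLex.mpr (Or.inr ⟨hDeq, hT⟩)
  -- no infinite descent in `ℕ ×ₗ ℕ`
  exact not_strictAnti_of_wellFoundedLT (fun n => toLex (D n, T n)) (strictAnti_nat_of_succ_lt hstep)


end Literature.AlgebraicGeometry.Resolution

end
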